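import Summits.HodgeConjecture.HodgeConjecture.Theorems.Ring2AbelianAllAndreStandardConjecturesAbelianVariety
import Literature.AlgebraicGeometry.HodgeTheory.HyperplaneClassHardLefschetzPullback
import Literature.AlgebraicGeometry.HodgeTheory.RelativeHyperplaneClassHodgeRiemann
import Literature.AlgebraicGeometry.HodgeTheory.HypersurfaceLefschetzProofs
import Literature.AlgebraicGeometry.HodgeTheory.PolarizationClassHardLefschetz
import Literature.AlgebraicGeometry.HodgeTheory.HodgeTypeOfFlatSectionsProjectiveTotal
import Literature.AlgebraicGeometry.HodgeTheory.HodgeTypeDimension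
import Literature.AlgebraicGeometry.HodgeTheory.MotivatedClassesTransport
import Literature.AlgebraicGeometry.HodgeTheory.IsoTransport
import HarnessLib

/-!
# Ring 2 — binder seat b02 (Hodge ladder stage 3): the LOWER SHADOW of a global class above the middle degree —
# the variational halving engine for row b02 `AbelianSchemeVHC`, fact-free on quasi-projective carriers

HONEST FRAMING: research route conditional on HC_CM; not a corollary; Q11.4-sentence-2 already refuted in dim ≥ 3.

Cell `pub-hodge-ring2`, binder seat `ring2-b02`, row b02 of `BINDER-OWNERS.md` (`Ring2.Hypotheses.AbelianSchemeVHC`: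
Grothendieck's variational Hodge conjecture, global-class form, along smooth projective families all of whose complex
fibres are abelian varieties; OPEN, print-equivalent to `HC_AV`). `HC_CM` (`Theses.RankFourFaces.CMAbelianHodge`) does
not occur below; nothing here is a case of the Hodge conjecture; no `sorry`, no definition, no named fact, no node.

WHAT THIS PART DOES. The rungs part (`Ring2BindersAbelianSchemeVHCRungs.lean`, p244633) recorded an HONEST LIMIT: row
b02 was NOT shown equivalent to its own lower half `2p ≤ n`, because descending `W|_{𝒳_s} = Lʲ c'_s` above the middle
to a VARIATIONAL statement below it needs (i) ONE global degree-2 class polarising every fibre, (ii) the theorem of the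
fixed part making `s ↦ c'_s` the restrictions of ONE class of the total space, (iii) `B(𝒳_s)` (Lieberman) to move
algebraicity DOWN the Lefschetz isomorphism. On the carriers with QUASI-PROJECTIVE total space all three are THEOREMS
of the tree, and this file assembles them (the sequel `Ring2BindersAbelianSchemeVHCHalving.lean` draws the binder-level
consequence `AbelianSchemeVHC ⟺ its lower half` modulo the print residual):

* §1 `exists_forall_isPolarizationClass_map_fiberι` — (i): the pull-back `K = ε^* r₀` of a rational generator `r₀` of
  `H²(ℙᴺ(ℂ); ℂ)` along a preimmersion `ε : 𝒳 → ℙᴺ` restricts on every fibre `𝒳_s ↪ ℙᴺ` to a POLARISATION CLASS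
  (rational: `IsRationalClass.map`; supported on a divisor: `map_projectiveSpace_mem_algebraicClasses`; hard
  Lefschetz: `hasHardLefschetzProperty_map_of_forall_eq_smul`, Voisin I Thm. 6.25 for the hyperplane class).
* §2 `continuous_mk_hardLefschetzPreimage` — the fibrewise hard-Lefschetz PREIMAGES `c'_s = (Lʲ_s)⁻¹(W|_{𝒳_s})` of a
  global class under a global Lefschetz class form a CONTINUOUS section of the espace étalé of `Rᵏ f_* ℂ` (over a
  trivialising open they are the restrictions of the tube preimage: cup products commute with restriction).
* §3 `mem_algebraicClasses_of_lefschetzPowTo_mem` (`A(X, κ)`: `Lʲ c` algebraic ⟹ `c` algebraic, `2l + j = n`) and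
  `standardConjectureA_of_iso_abelianVariety` (`A(X, κ)` for every polarisation class of an `X ≅` a complex abelian
  variety: Lieberman's `B(A)`, part XXII-c, through `Ring2.AbelianAll.standardConjectureA_abelianVariety` and
  `standardConjectureA_map_of_iso`).
* §4 **THE LOWER SHADOW** `exists_lowerShadow`: on a smooth projective family of abelian varieties of relative dimension
  `n = 2q + j` with quasi-projective total space over a smooth irreducible quasi-projective base, every global class
  `W` of degree `2(q+j)` fibrewise rational of type `(q+j, q+j)` has a global SHADOW `W'` of degree `2q`, fibrewise
  rational of type `(q, q)`, with `W'|_{𝒳_s}` algebraic ⟺ `W|_{𝒳_s}` algebraic for EVERY `s` — the two algebraicity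
  loci COINCIDE as sets ((ii) is Deligne 1968 / Voisin II Thm. 4.18 with the identity principle, the tree's
  `exists_forall_eq_globalSection_of_isQuasiProjectiveOver`; `⟹` is (iii); `⟸` is `[H]ʲ ∪ [Z] = [Hʲ·Z]`).
* §5 `map_fiberι_mem_algebraicClasses_of_lowerHalf` — PER FAMILY: on such a carrier the conclusion of row b02 on any
  prescribed set of fibres, in EVERY codimension, follows from the same in codimensions `2p ≤ n`.

Everything is FACT-FREE (closures: the three standard axioms). What is NOT claimed: any case of `AbelianSchemeVHC` or of
HC; anything about `HC_CM`; anything for carriers whose total space is not quasi-projective (there (i) is the print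
residual N96/N97 of part (v7), Raynaud 1970 — see the sequel).

References: [Grothendieck1966] footnote 13; [CharlesSchnell2014Notes] Conj. 11.3.1, Prop. 11.3.5 and its proof;
[VoisinHodgeI2002] Thm. 6.25, Rem. 6.27, §7.1.2, Thm. 7.10; [VoisinHodgeII2003] Thm. 4.18, Rem. 4.16, Lemma 4.17,
§1.2.3 Cor. 1.24, §9.2.4 Prop. 9.20; [Deligne1968] Thm. 1.5, Prop. 2.1; [KerrPearlstein2011] §3.1; [Lieberman1968] main
theorem; [Kleiman1968AlgebraicCycles] §2, Thm. 2A11; [Grothendieck1968] §3 p. 196; [HatcherAT2002] Prop. 3.10;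
[Hartshorne1977] II §4 Cor. 4.8, Ex. 4.9.
-/

-- every declaration of this problem lives in `Summit.HodgeConjecture.HodgeConjecture.…` (summit = sub-problem);
-- namespace `…Ring2.Binders` = the binder seats of the cell's Hodge-ladder stage 3 (`BINDER-OWNERS.md`)
set_option linter.dupNamespace false

noncomputable section

open CategoryTheory AlgebraicGeometry Topology Filter
open Literature.AlgebraicGeometry Literature.AlgebraicGeometry.Motives
open Literature.AlgebraicGeometry.HodgeTheory
open Literature.AlgebraicTopology.SingularHomology (singularCohomology)
open Literature.Geometry.Kaehler (lefschetzPow lefschetzPow_map HasHardLefschetzProperty)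

namespace Summit.HodgeConjecture.HodgeConjecture.Ring2.Binders

open Summit.HodgeConjecture.HodgeConjecture.Ring2.AbelianAll (standardConjectureA_abelianVariety
  standardConjectureA_map_of_iso)

variable {𝒳 S : SchemeOver ℂ}

/-! ## §1 One global class polarising every fibre (quasi-projective total space) -/

/-- **The relative hyperplane class polarises every fibre.** For a smooth projective family `f : 𝒳 ⟶ S` of relative
dimension `n` with `𝒳` quasi-projective over a separated `S`, there is ONE class `K ∈ H²(𝒳(ℂ); ℂ)` — the pull-back of
a rational generator `r₀` of `H²(ℙᴺ(ℂ); ℂ)` along a preimmersion `ε : 𝒳 → ℙᴺ` — whose restriction to every fibre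
`𝒳_s ↪ 𝒳 → ℙᴺ` (a closed immersion) is a polarisation class in dimension `n`: rational, supported on a divisor
(classes restricted from projective space are algebraic), and hard Lefschetz (Voisin I Thm. 6.25 for the
hyperplane-type Kähler class, of which `ε^* r₀|_{𝒳_s}` is a non-zero multiple).
[cite: VoisinHodgeI2002, Thm. 6.25, Thm. 7.10 and §7.1.2] [cite: VoisinHodgeII2003, §1.2.3 Cor. 1.24 and Thm. 4.15]
[cite: Hartshorne1977, II Cor. 4.8 and Ex. 4.9] -/
theorem exists_forall_isPolarizationClass_map_fiberι (f : 𝒳 ⟶ S) {n : ℕ} (hf : IsSmoothProjectiveFamily f n)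
    (h𝒳 : IsQuasiProjectiveOver 𝒳) [IsSeparated S.hom] :
    ∃ K : complexBetti 𝒳 2, ∀ s : ComplexPoints S,
      IsPolarizationClass n (fiberOver f s) (complexBetti.map (fiberι f s) 2 K) := by
  haveI : IsProper f.left := hf.isProper
  obtain ⟨N, ε, hε⟩ := h𝒳.exists_isPreimmersion
  haveI := hε
  obtain ⟨r₀, hr₀, hgen⟩ := exists_isRationalClass_forall_eq_smul_projectiveSpace N
  refine ⟨complexBetti.map ε 2 r₀, fun s ↦ ?_⟩
  haveI := isClosedImmersion_fiberι_comp_left_of_isPreimmersion f ε s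
  have heq : complexBetti.map (fiberι f s) 2 (complexBetti.map ε 2 r₀) = complexBetti.map (fiberι f s ≫ ε) 2 r₀ := by
    rw [complexBetti.map_comp]; rfl
  rw [heq]
  exact ⟨hr₀.map _, map_projectiveSpace_mem_algebraicClasses (hf.isSmoothProjective s) (fiberι f s ≫ ε) 1 r₀,
    hasHardLefschetzProperty_map_of_forall_eq_smul (hf.isSmoothProjective s) (fiberι f s ≫ ε) hgen⟩

/-! ## §2 Hard-Lefschetz preimages of a global class form a continuous section of the espace étalé -/

/-- **Fibrewise hard-Lefschetz preimages vary continuously.** Let `Rᵏ f_* ℂ` be a local system on `S(ℂ)` (`f`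
cohomologically locally trivial), `K ∈ H²(𝒳(ℂ); ℂ)` and `W ∈ Hᵐ(𝒳(ℂ); ℂ)`, `m = k + 2j`, global classes with
`Lʲ_{K|_{𝒳_s}} : Hᵏ(𝒳_s(ℂ)) → Hᵐ(𝒳_s(ℂ))` bijective for every `s`, and `c s` THE preimage of `W|_{𝒳_s}`. Then
`s ↦ (s, c s)` is a continuous section of `FiberClass f k`: over a trivialising open `B ∋ s₀` the tube class `ξ`
restricting to `c s₀` satisfies `Lʲ_{K|_B} ξ = W|_B` (checked on `𝒳_{s₀}`; cup products commute with restriction),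
hence restricts to `c s` at every `s ∈ B`. [cite: VoisinHodgeII2003, Remark 4.16 and Lemma 4.17]
[cite: HatcherAT2002, Prop. 3.10] -/
theorem continuous_mk_hardLefschetzPreimage (f : 𝒳 ⟶ S)
    (hU : IsCohomologicallyLocallyTrivialOn f (Set.univ : Set (ComplexPoints S)))
    (K : complexBetti 𝒳 2) {j k m : ℕ} (hm : k + 2 * j = m) (W : complexBetti 𝒳 m)
    (hbij : ∀ s : ComplexPoints S,
      Function.Bijective (lefschetzPowTo (complexBetti.map (fiberι f s) 2 K) j k m hm))
    (c : ∀ s : ComplexPoints S, complexBetti (fiberOver f s) k)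
    (hc : ∀ s, lefschetzPowTo (complexBetti.map (fiberι f s) 2 K) j k m hm (c s) = complexBetti.map (fiberι f s) m W) :
    Continuous fun s ↦ (⟨s, c s⟩ : FiberClass f k) := by
  subst hm
  -- cup products commute with restriction from a tube to a fibre
  have nat : ∀ {B : Set (ComplexPoints S)} {s : ComplexPoints S} (hs : s ∈ B)
      (x : singularCohomology ℂ ℂ (tubeOver f B) k),
      fiberRestrict f hs (k + 2 * j) (lefschetzPow (restrictTube f B 2 K) j k x) =
        lefschetzPow (complexBetti.map (fiberι f s) 2 K) j k (fiberRestrict f hs k x) := by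
    intro B s hs x
    rw [← fiberRestrict_restrictTube_apply f hs 2 K]
    exact lefschetzPow_map (fiberToTube f hs) (restrictTube f B 2 K) j k x
  refine continuous_iff_continuousAt.2 fun s₀ ↦ ?_
  obtain ⟨B, hBo, h₀B, -, -, hbijB⟩ := hU.exists_nhds_bijective (Set.mem_univ s₀) Set.univ Filter.univ_mem
  obtain ⟨ξ, hξ⟩ := (hbijB k h₀B).2 (c s₀)
  -- `Lʲ_{K|_B} ξ = W|_B`, checked on the fibre over `s₀`
  have hLξ : lefschetzPow (restrictTube f B 2 K) j k ξ = restrictTube f B (k + 2 * j) W := by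
    apply (hbijB (k + 2 * j) h₀B).1
    rw [nat h₀B ξ, hξ, fiberRestrict_restrictTube_apply]
    exact hc s₀
  refine FiberClass.continuousAt_of_eventually_eq_tubeSection continuous_id.continuousAt hBo ξ ?_
  filter_upwards [hBo.mem_nhds h₀B] with s hsB
  refine ⟨hsB, ?_⟩
  change (⟨s, c s⟩ : FiberClass f k) = ⟨s, fiberRestrict f hsB k ξ⟩
  rw [FiberClass.mk_eq_mk_iff]
  apply (hbij s).1
  change lefschetzPow _ j k (c s) = lefschetzPow _ j k _
  rw [← nat hsB ξ, hLξ, fiberRestrict_restrictTube_apply]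
  exact hc s

/-! ## §3 `A(X, κ)`: algebraicity descends the Lefschetz isomorphism; `A` at a fibre presented as an abelian variety -/

/-- **Granted `A(X, κ)`, `Lʲ c` algebraic ⟹ `c` algebraic** (`2l + j = n`): by the surjectivity clause `Lʲ c = Lʲ a`
with `a` algebraic of codimension `l`, and `Lʲ` is injective on `H^{2l}` (hard Lefschetz). The target degree `m` and
codimension `q` are variables so that consumers need no arithmetic on indices.
[cite: Grothendieck1968, §3 p. 196 (A(X))] [cite: Kleiman1968AlgebraicCycles, §2] -/
theorem mem_algebraicClasses_of_lefschetzPowTo_mem {X : SchemeOver ℂ} {n : ℕ} {κ : complexBetti X 2}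
    (hA : StandardConjectureA n X κ) {l j : ℕ} (hlj : 2 * l + j = n) {m : ℕ} (hm : 2 * l + 2 * j = m) {q : ℕ}
    (hq : l + j = q) (c : complexBetti X (2 * l)) (h : lefschetzPowTo κ j (2 * l) m hm c ∈ supportedClasses X m q) :
    c ∈ algebraicClasses X l := by
  subst hm hq
  obtain ⟨a, ha, hac⟩ := (hA.2 l j (l + j) hlj rfl).2.2 h
  have hac' : lefschetzPow κ j (2 * l) a = lefschetzPow κ j (2 * l) c := hac
  rw [← (hA.1 j (2 * l) hlj).1 hac']
  exact ha

/-- **`A(X, κ)` for a smooth projective `X` isomorphic to a complex abelian variety and every polarisation class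
`κ`**: Lieberman's `B(A)` ⟹ `A(A, e^*κ)` (`Ring2.AbelianAll.standardConjectureA_abelianVariety`, unconditional in the
tree), transported along `e : A.X ≅ X` (`standardConjectureA_map_of_iso`). [cite: Lieberman1968, main theorem]
[cite: Kleiman1968AlgebraicCycles, Appendix to §2, Thm. 2A11] [cite: Grothendieck1968, §3 p. 196] -/
theorem standardConjectureA_of_iso_abelianVariety {X : SchemeOver ℂ} {n : ℕ} (hX : IsSmoothProjective n X)
    {A : AbelianVariety ℂ} (hA : A.dim = n) (e : A.X ≅ X) {κ : complexBetti X 2}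
    (hκ : IsPolarizationClass n X κ) : StandardConjectureA n X κ := by
  subst hA
  have hκA : IsPolarizationClass A.dim A.X (complexBetti.map e.hom 2 κ) :=
    IsPolarizationClass.map_of_iso hX (AbelianVariety.isSmoothProjective_holds (A := A)) e hκ
  have h := standardConjectureA_map_of_iso e.symm (standardConjectureA_abelianVariety A hκA)
  rwa [Iso.symm_hom, e.complexBetti_map_inv_map_hom] at h

/-! ## §4 The lower shadow of a global class above the middle -/

/-- **THE LOWER SHADOW.** Let `f : 𝒳 ⟶ S` be a smooth projective family of relative dimension `n = 2q + j` with
quasi-projective total space over a smooth irreducible quasi-projective `S`, all complex fibres abelian varieties, and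
`W ∈ H^{2(q+j)}(𝒳(ℂ); ℂ)` fibrewise rational of type `(q+j, q+j)`. Then there is `W' ∈ H^{2q}(𝒳(ℂ); ℂ)`, fibrewise
rational of type `(q, q)`, such that for EVERY `s`, `W'|_{𝒳_s}` is algebraic iff `W|_{𝒳_s}` is. Construction: `K` the
global polarising class (§1), `Λ_s` its hard Lefschetz datum on `𝒳_s` (`IsPolarizationClass.exists_hardLefschetzNFold`),
`c'_s` the rational `(q,q)` preimage of `W|_{𝒳_s}` under `Lʲ_s` (`HardLefschetzNFold.exists_hdg_preimage`); `s ↦ c'_s`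
is a continuous section (§2), hence the global section of ONE class `W'` (Deligne 1968 / Voisin II Thm. 4.18 with the
identity principle: the tree theorem `exists_forall_eq_globalSection_of_isQuasiProjectiveOver`); `⟹` is
`A(𝒳_s, K|_{𝒳_s})` (§3, Lieberman), `⟸` is `[H]ʲ ∪ [Z] = [Hʲ·Z]` (`HardLefschetzNFold.L_mem_algebraicClasses_of_mem`).
FACT-FREE. [cite: VoisinHodgeII2003, Thm. 4.18 and §9.2.4 Prop. 9.20] [cite: VoisinHodgeI2002, Thm. 6.25, Rem. 6.27 and §7.1.2]
[cite: Lieberman1968, main theorem] [cite: KerrPearlstein2011, §3.1] -/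
theorem exists_lowerShadow (f : 𝒳 ⟶ S) {n : ℕ} (hf : IsSmoothProjectiveFamily f n) (h𝒳 : IsQuasiProjectiveOver 𝒳)
    (hS : IsQuasiProjectiveOver S) [IrreducibleSpace S.left] (hSs : AlgebraicGeometry.Smooth S.hom)
    (hA : ∀ s : ComplexPoints S, ∃ A' : AbelianVariety ℂ, A'.dim = n ∧ Nonempty (A'.X ≅ fiberOver f s))
    {q j : ℕ} (hqj : 2 * q + j = n) (W : complexBetti 𝒳 (2 * (q + j)))
    (hW : ∀ s : ComplexPoints S, IsRationalClass (complexBetti.map (fiberι f s) (2 * (q + j)) W) ∧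
      IsOfHodgeType n (fiberOver f s) (2 * (q + j)) (q + j) (q + j) (complexBetti.map (fiberι f s) (2 * (q + j)) W)) :
    ∃ W' : complexBetti 𝒳 (2 * q),
      (∀ s : ComplexPoints S, IsRationalClass (complexBetti.map (fiberι f s) (2 * q) W') ∧
        IsOfHodgeType n (fiberOver f s) (2 * q) q q (complexBetti.map (fiberι f s) (2 * q) W')) ∧
      ∀ s : ComplexPoints S, complexBetti.map (fiberι f s) (2 * q) W' ∈ algebraicClasses (fiberOver f s) q ↔
        complexBetti.map (fiberι f s) (2 * (q + j)) W ∈ algebraicClasses (fiberOver f s) (q + j) := by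
  haveI := hSs
  haveI : IsSeparated S.hom := hS.isSeparated
  haveI : LocallyOfFiniteType S.hom := inferInstance
  haveI : ConnectedSpace (ComplexPoints S) := (ComplexPoints.connectedSpace_iff_holds S).2 inferInstance
  have hm : 2 * q + 2 * j = 2 * (q + j) := by omega
  -- (i) the global polarising class and its hard Lefschetz data on the fibres
  obtain ⟨K, hK⟩ := exists_forall_isPolarizationClass_map_fiberι f hf h𝒳
  choose Λ hΛ using fun s ↦ (hK s).exists_hardLefschetzNFold (hf.isSmoothProjective s)
  -- the fibrewise rational `(q,q)` preimages
  have hex : ∀ s : ComplexPoints S, ∃ c' : complexBetti (fiberOver f s) (2 * q),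
      IsRationalClass c' ∧ IsOfHodgeType n (fiberOver f s) (2 * q) q q c' ∧
        (Λ s).L j (2 * q) (2 * (q + j)) hm c' = complexBetti.map (fiberι f s) (2 * (q + j)) W :=
    fun s ↦ (Λ s).exists_hdg_preimage hqj (2 * (q + j)) hm q q _ (hW s).1 (hW s).2
  choose c hc₁ hc₂ hc₃ using hex
  have hc₃' : ∀ s, lefschetzPowTo (complexBetti.map (fiberι f s) 2 K) j (2 * q) (2 * (q + j)) hm (c s) =
      complexBetti.map (fiberι f s) (2 * (q + j)) W := fun s ↦ by rw [← hΛ s]; exact hc₃ s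
  have hbij : ∀ s, Function.Bijective
      (lefschetzPowTo (complexBetti.map (fiberι f s) 2 K) j (2 * q) (2 * (q + j)) hm) := fun s ↦ by
    rw [← hΛ s]; exact (Λ s).bijective_L hqj _ hm
  -- (ii) continuity, and ONE global class restricting to every preimage
  have hσ : Continuous fun s ↦ (⟨s, c s⟩ : FiberClass f (2 * q)) :=
    continuous_mk_hardLefschetzPreimage f (isCohomologicallyLocallyTrivialOn_univ_of_isSmoothProjectiveFamily_of_smooth f hf)
      K hm W hbij c hc₃'
  rcases isEmpty_or_nonempty (ComplexPoints S) with hS0 | ⟨⟨s₀⟩⟩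
  · exact ⟨0, fun s ↦ (hS0.false s).elim, fun s ↦ (hS0.false s).elim⟩
  obtain ⟨W', hW'⟩ := exists_forall_eq_globalSection_of_isQuasiProjectiveOver f hf h𝒳 hS hσ (fun _ ↦ rfl) s₀
  have hcW' : ∀ s, c s = complexBetti.map (fiberι f s) (2 * q) W' :=
    fun s ↦ (FiberClass.mk_eq_mk_iff _ _).1 (hW' s)
  refine ⟨W', fun s ↦ ⟨hcW' s ▸ hc₁ s, hcW' s ▸ hc₂ s⟩, fun s ↦ ⟨fun h ↦ ?_, fun h ↦ ?_⟩⟩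
  · -- `⟸`: `Lʲ` moves algebraic classes
    rw [← hc₃ s, hcW' s]
    exact (Λ s).L_mem_algebraicClasses_of_mem j q hm h
  · -- `⟹`: `A(𝒳_s, K|_{𝒳_s})` (Lieberman)
    obtain ⟨A', hA'dim, ⟨e⟩⟩ := hA s
    rw [← hcW' s]
    exact mem_algebraicClasses_of_lefschetzPowTo_mem
      (standardConjectureA_of_iso_abelianVariety (hf.isSmoothProjective s) hA'dim e (hK s)) hqj hm rfl (c s)
      (by rw [hc₃' s]; exact h)

/-! ## §5 Per family: the lower half of the codimensions decides (fact-free) -/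

/-- **On a quasi-projective abelian-fibred carrier, the conclusion of row b02 in EVERY codimension follows from the
conclusion in codimensions `2p ≤ n`** — for any prescribed set `T` of fibres and anchor `s₀`: above the middle
(`n < 2p ≤ 2n`) pass to the lower shadow (§4), which is algebraic exactly where `W` is; beyond `p > n` there are no
non-zero `(p,p)`-classes (`IsOfHodgeType.eq_zero_pp_of_lt`). [cite: KerrPearlstein2011, §3.1]
[cite: VoisinHodgeII2003, Thm. 4.18] [cite: Lieberman1968, main theorem] -/
theorem map_fiberι_mem_algebraicClasses_of_lowerHalf (f : 𝒳 ⟶ S) {n : ℕ} (hf : IsSmoothProjectiveFamily f n)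
    (h𝒳 : IsQuasiProjectiveOver 𝒳) (hS : IsQuasiProjectiveOver S) [IrreducibleSpace S.left]
    (hSs : AlgebraicGeometry.Smooth S.hom)
    (hA : ∀ s : ComplexPoints S, ∃ A' : AbelianVariety ℂ, A'.dim = n ∧ Nonempty (A'.X ≅ fiberOver f s))
    (T : Set (ComplexPoints S)) {s₀ : ComplexPoints S}
    (hlow : ∀ q : ℕ, 2 * q ≤ n → ∀ W' : complexBetti 𝒳 (2 * q),
      (∀ s : ComplexPoints S, IsRationalClass (complexBetti.map (fiberι f s) (2 * q) W') ∧
        IsOfHodgeType n (fiberOver f s) (2 * q) q q (complexBetti.map (fiberι f s) (2 * q) W')) →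
      complexBetti.map (fiberι f s₀) (2 * q) W' ∈ algebraicClasses (fiberOver f s₀) q →
      ∀ s ∈ T, complexBetti.map (fiberι f s) (2 * q) W' ∈ algebraicClasses (fiberOver f s) q)
    (p : ℕ) (W : complexBetti 𝒳 (2 * p))
    (hW : ∀ s : ComplexPoints S, IsRationalClass (complexBetti.map (fiberι f s) (2 * p) W) ∧
      IsOfHodgeType n (fiberOver f s) (2 * p) p p (complexBetti.map (fiberι f s) (2 * p) W))
    (h₀ : complexBetti.map (fiberι f s₀) (2 * p) W ∈ algebraicClasses (fiberOver f s₀) p) :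
    ∀ s ∈ T, complexBetti.map (fiberι f s) (2 * p) W ∈ algebraicClasses (fiberOver f s) p := by
  intro s hs
  by_cases hpn : 2 * p ≤ n
  · exact hlow p hpn W hW h₀ s hs
  by_cases hnp : n < p
  · rw [(hW s).2.eq_zero_pp_of_lt hnp]
    exact Submodule.zero_mem _
  obtain ⟨q, j, hqj, hp⟩ : ∃ q j : ℕ, 2 * q + j = n ∧ q + j = p := ⟨n - p, 2 * p - n, by omega, by omega⟩
  subst hp
  obtain ⟨W', hW', hiff⟩ := exists_lowerShadow f hf h𝒳 hS hSs hA hqj W hW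
  exact (hiff s).1 (hlow q (by omega) W' hW' ((hiff s₀).2 h₀) s hs)

/-! ## Audit: fact-free (closures are the three standard axioms; no named fact, no `HC_CM`) -/

#print axioms Summit.HodgeConjecture.HodgeConjecture.Ring2.Binders.exists_forall_isPolarizationClass_map_fiberι
#print axioms Summit.HodgeConjecture.HodgeConjecture.Ring2.Binders.exists_lowerShadow
#print axioms Summit.HodgeConjecture.HodgeConjecture.Ring2.Binders.map_fiberι_mem_algebraicClasses_of_lowerHalf

end Summit.HodgeConjecture.HodgeConjecture.Ring2.Binders

end
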